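import Summits.QuantumFields.BalabanUV.Beta.SymAveragingHessianCountsWords

/-!
# `BalabanUV.Beta.SymAveragingHessianCounts` — TABLES-SYM step S2a (an1 gen 41), PART 2∕3

This file is one of THREE parts of an1's single scratch module `SymAveragingHessianCounts.lean` (sha16 05392941d6166f37, 1001 l.; COURIER ASK
journal [AN1-G41-S2A] ∕ RE-OFFER [AN1-G42-ONLINE]), split MECHANICALLY at its own section boundaries because the gate's `lint.size` caps files at
400 lines; the namespace spans the three files; every declaration is byte-identical to an1's and in the original order (courier:
b2b-balaban-beta-d1-formalise-leaf-02 gen 12, script `split_s2a.py`).  The FULL header (honest framing, WHY, WHAT, NOT HERE, ABSOLUTE RULE,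
provenance, bib locators) is in part 1 `SymAveragingHessianCountsWords.lean` and applies verbatim to this part.  CONTENT OF THIS PART: §4 Support (box root), §5 Entry bounds, §6 Block-translation covariance.
HONEST (verbatim from part 1): [folklore] letter-list algebra and box sums on `ℤ^d`; 0 sorry, 0 `def … : Prop`, nothing cited as a fact;
NOT D1, NOT BetaPertH, NOT continuum, NOT Clay.  HONEST DEPENDENCY: continuum YM on T⁴ ⇐ BetaPertH ∧ nine spine estimates (0/9 proved);
BetaPertH ⇐ (D1) ∧ (D4) ∧ CAP+tail; G-an2-4 gates asym, D1 and NE2/3/4.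
-/

namespace Summit.QuantumFields.BalabanUV.Beta.SymAveragingHessianCounts

open Finset
open scoped BigOperators Nat
open Literature.MathematicalPhysics.QuantumFieldTheory.Balaban1983to89.Beta
open Literature.MathematicalPhysics.QuantumFieldTheory.Balaban1983to89.Beta.AffineAveraging
open Literature.MathematicalPhysics.QuantumFieldTheory.Balaban1983to89.Beta.AveragingContours
open Literature.MathematicalPhysics.QuantumFieldTheory.Balaban1983to89.Beta.AveragingContoursRooted
open Literature.MathematicalPhysics.QuantumFieldTheory.Balaban1983to89.Beta.TransportedContourVariables
open Literature.MathematicalPhysics.QuantumFieldTheory.Balaban1983to89.Beta.AveragingHessianKernels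
open Literature.MathematicalPhysics.QuantumFieldTheory.Balaban1983to89.Beta.AveragingHessianKernelsRooted
open Summit.QuantumFields.BalabanUV.Beta.KernelPermutation (psite psite_apply psite_symm_apply psite_add psite_sub psite_smul)
open Summit.QuantumFields.BalabanUV.Beta.ResolventPermutation (P1 P1_apply psite_unitVec sum_box_psite toSite_psite psite_block psite_mem_box)
open Summit.QuantumFields.BalabanUV.Beta.SymmetrisedAxialPotential (axialPerm symAxial symLinAvgAt card_perm_fin psite_symm_add
  psite_symm_smul psite_symm_unitVec)

variable {d : ℕ}

/-! ## §4 Support (box root): node 7a's support box `Near L y` holds every letter of every pair word -/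

section Support

variable {R : Type*} [AddCommGroup R]

/-- [folklore] Every letter of `γ^{σ,σ′}_x`, `x ∈ B(y)`, `ρ = toSite r`, `r ∈ box`, is a bond based in the support box. -/
theorem lettersIn_gammaPAt (σ σ' : Equiv.Perm (Fin d)) (A : Form1 d R) (L : ℕ) (μ : Fin d) (y : Site d) {r b : Fin d → ℕ}
    (hr : r ∈ box d L) (hb : b ∈ box d L) : LettersIn A (Near L y) (gammaPAt σ σ' (toSite r) A L μ y b) := by
  have hr' : ∀ i, r i < L := by simpa [AffineAveraging.box, Fintype.mem_piFinset, Finset.mem_range] using hr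
  have hb' : ∀ i, b i < L := by simpa [AffineAveraging.box, Fintype.mem_piFinset, Finset.mem_range] using hb
  refine LettersIn.append (LettersIn.append ?_ ?_) ?_
  · refine (lettersIn_axialP σ A _ _).mono fun x' hx' i => ?_
    obtain ⟨h1, h2⟩ := hx' i
    have hi := hb' i; have hri := hr' i
    simp only [Pi.add_apply, Pi.smul_apply, smul_eq_mul, toSite] at h1 h2
    rw [min_le_iff] at h1; rw [le_max_iff] at h2
    constructor <;> omega
  · intro a ha
    obtain ⟨s, hs', rfl⟩ := mem_segUp ha
    refine ⟨μ, _, fun i => ?_, Or.inl rfl⟩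
    have hi := hb' i
    simp only [Pi.add_apply, Pi.smul_apply, smul_eq_mul, toSite, unitVec_apply]
    split_ifs <;> constructor <;> omega
  · refine (lettersIn_axialP σ' A _ _).rev.mono fun x' hx' i => ?_
    obtain ⟨h1, h2⟩ := hx' i
    have hi := hb' i; have hri := hr' i
    simp only [Pi.add_apply, Pi.smul_apply, smul_eq_mul, toSite, unitVec_apply] at h1 h2
    rw [min_le_iff] at h1; rw [le_max_iff] at h2
    split_ifs at h1 h2 <;> constructor <;> omega

/-- [folklore] Every letter of the closed pair loop is based in the support box. -/
theorem lettersIn_loopPAt (σ σ' : Equiv.Perm (Fin d)) (A : Form1 d R) (L : ℕ) (μ : Fin d) (y : Site d) {r b : Fin d → ℕ}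
    (hr : r ∈ box d L) (hb : b ∈ box d L) : LettersIn A (Near L y) (loopPAt σ σ' (toSite r) A L μ y b) :=
  (lettersIn_gammaPAt σ σ' A L μ y hr hb).append (lettersIn_cSegAt A L μ y hr).rev

/-! ### FINITE RANGE of the symmetrised count tables (box root) -/

/-- [folklore] `symLinCountAt` vanishes off the support box. -/
theorem symLinCountAt_eq_zero {L : ℕ} {μ : Fin d} {y : Site d} {r : Fin d → ℕ} (hr : r ∈ box d L) {f : Bond d}
    (h : ¬ Near L y f.2) : symLinCountAt (toSite r) L μ y f = 0 :=
  Finset.sum_eq_zero fun σ _ => Finset.sum_eq_zero fun _ hb => sum_eq_zero_of_lettersIn h (lettersIn_gammaPAt σ σ _ L μ y hr hb)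

/-- [folklore] `symWedgeCountAt` vanishes when the first bond is off the support box. -/
theorem symWedgeCountAt_eq_zero_left {L : ℕ} {μ : Fin d} {y : Site d} {r : Fin d → ℕ} (hr : r ∈ box d L) {f : Bond d}
    (h : ¬ Near L y f.2) (f' : Bond d) : symWedgeCountAt (toSite r) L μ y f f' = 0 :=
  Finset.sum_eq_zero fun _ hb => Finset.sum_eq_zero fun σ _ => Finset.sum_eq_zero fun σ' _ =>
    wedge_eq_zero_of_fst _ (fst_eq_zero_of_lettersIn h (lettersIn_loopPAt σ σ' _ L μ y hr hb))

/-- [folklore] `symWedgeCountAt` vanishes when the second bond is off the support box. -/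
theorem symWedgeCountAt_eq_zero_right {L : ℕ} {μ : Fin d} {y : Site d} {r : Fin d → ℕ} (hr : r ∈ box d L) (f : Bond d)
    {f' : Bond d} (h : ¬ Near L y f'.2) : symWedgeCountAt (toSite r) L μ y f f' = 0 := by
  rw [← neg_neg (symWedgeCountAt (toSite r) L μ y f f'), ← symWedgeCountAt_swap, symWedgeCountAt_eq_zero_left hr h, neg_zero]

/-- [folklore] `symHessCountAt` vanishes when the first bond is off the support box. -/
theorem symHessCountAt_eq_zero_left {L : ℕ} {μ : Fin d} {y : Site d} {r : Fin d → ℕ} (hr : r ∈ box d L) {f : Bond d}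
    (h : ¬ Near L y f.2) (f' : Bond d) : symHessCountAt (toSite r) L μ y f f' = 0 := by
  have h2 : wedge (segUp (pairForm (δ1 f) (δ1 f')) ((L : ℤ) • y + toSite r) μ L) = 0 :=
    wedge_eq_zero_of_fst _ (fst_eq_zero_of_lettersIn h (lettersIn_cSegAt _ L μ y hr))
  rw [symHessCountAt, symWedgeCountAt_eq_zero_left hr h, h2, symLinCountAt_eq_zero hr h, cCountAt_eq_zero hr h]
  ring

/-- [folklore] `symHessCountAt` vanishes when the second bond is off the support box. -/
theorem symHessCountAt_eq_zero_right {L : ℕ} {μ : Fin d} {y : Site d} {r : Fin d → ℕ} (hr : r ∈ box d L) (f : Bond d)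
    {f' : Bond d} (h : ¬ Near L y f'.2) : symHessCountAt (toSite r) L μ y f f' = 0 := by
  rw [← neg_neg (symHessCountAt (toSite r) L μ y f f'), ← symHessCountAt_swap, symHessCountAt_eq_zero_left hr h, neg_zero]

/-- [folklore] `symVhCountAt` vanishes when the first bond is off the support box. -/
theorem symVhCountAt_eq_zero_left {L : ℕ} {μ : Fin d} {y : Site d} {r : Fin d → ℕ} (hr : r ∈ box d L) {f : Bond d}
    (h : ¬ Near L y f.2) (f' : Bond d) : symVhCountAt (toSite r) L μ y f f' = 0 := by
  rw [symVhCountAt, symHessCountAt_eq_zero_left hr h, symLinCountAt_eq_zero hr h]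
  split_ifs <;> simp

/-- [folklore] `symVhCountAt` vanishes when the second bond is off the support box. -/
theorem symVhCountAt_eq_zero_right {L : ℕ} {μ : Fin d} {y : Site d} {r : Fin d → ℕ} (hr : r ∈ box d L) (f : Bond d)
    {f' : Bond d} (h : ¬ Near L y f'.2) : symVhCountAt (toSite r) L μ y f f' = 0 := by
  rw [symVhCountAt, symHessCountAt_eq_zero_right hr f h, symLinCountAt_eq_zero hr h]
  split_ifs with e
  · subst e; rw [symLinCountAt_eq_zero hr h]; simp
  · simp

end Support

/-! ## §5 Entry bounds (box root; node 7a's `ell d L = (2d+2)L`) -/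

section Bounds

/-- [folklore] `|γ^{σ,σ′}_x ∪ (−c)| ≤ ℓ`. -/
theorem loopPAt_length_le_ell {R : Type*} [AddCommGroup R] (σ σ' : Equiv.Perm (Fin d)) (A : Form1 d R) {L : ℕ} (hL : 1 ≤ L)
    (μ : Fin d) (y : Site d) {r b : Fin d → ℕ} (hr : r ∈ box d L) (hb : b ∈ box d L) :
    (loopPAt σ σ' (toSite r) A L μ y b).length ≤ ell d L := by
  have hr' : ∀ i, r i < L := by simpa [AffineAveraging.box, Fintype.mem_piFinset, Finset.mem_range] using hr
  have hb' : ∀ i, b i < L := by simpa [AffineAveraging.box, Fintype.mem_piFinset, Finset.mem_range] using hb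
  have h1 : (axialP σ A ((L : ℤ) • y + toSite r) ((L : ℤ) • y + toSite b)).length ≤ d * (L - 1) :=
    axialP_length_root_block σ A _ hr' hb'
  have hx : (L : ℤ) • y + toSite b + (L : ℤ) • unitVec μ = ((L : ℤ) • y + (L : ℤ) • unitVec μ) + toSite b := by abel
  have hρ : (L : ℤ) • y + toSite r + (L : ℤ) • unitVec μ = ((L : ℤ) • y + (L : ℤ) • unitVec μ) + toSite r := by abel
  have h2 : (axialP σ' A ((L : ℤ) • y + toSite r + (L : ℤ) • unitVec μ) ((L : ℤ) • y + toSite b + (L : ℤ) • unitVec μ)).length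
      ≤ d * (L - 1) := by
    rw [hx, hρ]; exact axialP_length_root_block σ' A _ hr' hb'
  simp only [loopPAt, gammaPAt, List.length_append, segUp_length, rev_length]
  unfold ell
  zify [hL] at h1 h2 ⊢
  nlinarith

/-- [folklore] `|γ^{σ,σ′}_x| ≤ ℓ`. -/
theorem gammaPAt_length_le_ell {R : Type*} [AddCommGroup R] (σ σ' : Equiv.Perm (Fin d)) (A : Form1 d R) {L : ℕ} (hL : 1 ≤ L)
    (μ : Fin d) (y : Site d) {r b : Fin d → ℕ} (hr : r ∈ box d L) (hb : b ∈ box d L) :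
    (gammaPAt σ σ' (toSite r) A L μ y b).length ≤ ell d L := by
  have h := loopPAt_length_le_ell σ σ' A hL μ y hr hb
  simp only [loopPAt, List.length_append] at h
  omega

/-- [folklore] `|box| = L^d`. -/
theorem card_box (L : ℕ) : (box d L).card = L ^ d := by simp [AffineAveraging.box, Fintype.card_piFinset]

/-- [folklore] `|LIN⁰⁴∕d!| ≤ d!·L^d·ℓ`. -/
theorem abs_symLinCountAt_le {L : ℕ} (hL : 1 ≤ L) (μ : Fin d) (y : Site d) {r : Fin d → ℕ} (hr : r ∈ box d L) (f : Bond d) :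
    |symLinCountAt (toSite r) L μ y f| ≤ (d ! : ℤ) * ((L : ℤ) ^ d * ell d L) := by
  unfold symLinCountAt symLinU
  refine (Finset.abs_sum_le_sum_abs _ _).trans ?_
  have h : ∀ σ ∈ (univ : Finset (Equiv.Perm (Fin d))),
      |∑ b ∈ box d L, (gammaPAt σ σ (toSite r) (δ1 f) L μ y b).sum| ≤ (L : ℤ) ^ d * ell d L := fun σ _ => by
    refine (Finset.abs_sum_le_sum_abs _ _).trans ?_
    have h' : ∀ b ∈ box d L, |(gammaPAt σ σ (toSite r) (δ1 f) L μ y b).sum| ≤ (ell d L : ℤ) := fun b hb =>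
      (abs_sum_le_length _ (abs_le_one_of_lettersIn (lettersIn_gammaPAt σ σ _ L μ y hr hb))).trans
        (by exact_mod_cast gammaPAt_length_le_ell σ σ _ hL μ y hr hb)
    refine (Finset.sum_le_card_nsmul _ _ _ h').trans ?_
    rw [card_box, nsmul_eq_mul]; push_cast; exact le_rfl
  refine (Finset.sum_le_card_nsmul _ _ _ h).trans ?_
  rw [Finset.card_univ, card_perm_fin, nsmul_eq_mul]

/-- [folklore] `|WED⁰⁴| ≤ (d!)²·L^d·ℓ²`. -/
theorem abs_symWedgeCountAt_le {L : ℕ} (hL : 1 ≤ L) (μ : Fin d) (y : Site d) {r : Fin d → ℕ} (hr : r ∈ box d L) (f f' : Bond d) :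
    |symWedgeCountAt (toSite r) L μ y f f'| ≤ (d ! : ℤ) ^ 2 * ((L : ℤ) ^ d * (ell d L : ℤ) ^ 2) := by
  unfold symWedgeCountAt
  have hσ' : ∀ (b : Fin d → ℕ), b ∈ box d L → ∀ σ : Equiv.Perm (Fin d), ∀ σ' ∈ (univ : Finset (Equiv.Perm (Fin d))),
      |wedge (loopPAt σ σ' (toSite r) (pairForm (δ1 f) (δ1 f')) L μ y b)| ≤ (ell d L : ℤ) ^ 2 := fun b hb σ σ' _ =>
    (abs_wedge_le _ (abs_le_one_of_lettersIn_pair (lettersIn_loopPAt σ σ' _ L μ y hr hb))).trans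
      (pow_le_pow_left₀ (by positivity) (by exact_mod_cast loopPAt_length_le_ell σ σ' _ hL μ y hr hb) 2)
  have hσ : ∀ (b : Fin d → ℕ), b ∈ box d L → ∀ σ ∈ (univ : Finset (Equiv.Perm (Fin d))),
      |∑ σ' : Equiv.Perm (Fin d), wedge (loopPAt σ σ' (toSite r) (pairForm (δ1 f) (δ1 f')) L μ y b)| ≤ (d ! : ℤ) * (ell d L : ℤ) ^ 2 :=
    fun b hb σ _ => by
    refine (Finset.abs_sum_le_sum_abs _ _).trans ((Finset.sum_le_card_nsmul _ _ _ (hσ' b hb σ)).trans ?_)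
    rw [Finset.card_univ, card_perm_fin, nsmul_eq_mul]
  have hb : ∀ b ∈ box d L, |∑ σ : Equiv.Perm (Fin d), ∑ σ' : Equiv.Perm (Fin d),
      wedge (loopPAt σ σ' (toSite r) (pairForm (δ1 f) (δ1 f')) L μ y b)| ≤ (d ! : ℤ) ^ 2 * (ell d L : ℤ) ^ 2 := fun b hb => by
    refine (Finset.abs_sum_le_sum_abs _ _).trans ((Finset.sum_le_card_nsmul _ _ _ (hσ b hb)).trans ?_)
    rw [Finset.card_univ, card_perm_fin, nsmul_eq_mul]; ring_nf; exact le_rfl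
  refine (Finset.abs_sum_le_sum_abs _ _).trans ((Finset.sum_le_card_nsmul _ _ _ hb).trans ?_)
  rw [card_box, nsmul_eq_mul]; push_cast; ring_nf; exact le_rfl

/-- [folklore] `|HESS⁰⁴| ≤ 4·(d!)²·L^d·ℓ²`. -/
theorem abs_symHessCountAt_le {L : ℕ} (hL : 1 ≤ L) (μ : Fin d) (y : Site d) {r : Fin d → ℕ} (hr : r ∈ box d L) (f f' : Bond d) :
    |symHessCountAt (toSite r) L μ y f f'| ≤ 4 * (d ! : ℤ) ^ 2 * (L : ℤ) ^ d * (ell d L : ℤ) ^ 2 := by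
  have hLd : (1 : ℤ) ≤ (L : ℤ) ^ d := by exact_mod_cast Nat.one_le_pow _ _ hL
  have hℓ : (L : ℤ) ≤ ell d L := by exact_mod_cast le_ell
  have hℓ0 : (0 : ℤ) ≤ L := by positivity
  have hfac : (1 : ℤ) ≤ d ! := by exact_mod_cast Nat.one_le_iff_ne_zero.mpr (Nat.factorial_ne_zero d)
  have h1 := abs_symWedgeCountAt_le hL μ y hr f f'
  have ha := abs_symLinCountAt_le hL μ y hr f
  have hb := abs_symLinCountAt_le hL μ y hr f'
  have hc := abs_cCountAt_le L μ y hr f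
  have hd := abs_cCountAt_le L μ y hr f'
  have h2 : |(d ! : ℤ) * (symLinCountAt (toSite r) L μ y f * cCountAt (toSite r) L μ y f'
      - symLinCountAt (toSite r) L μ y f' * cCountAt (toSite r) L μ y f)| ≤ 2 * ((d ! : ℤ) ^ 2 * ((L : ℤ) ^ d * (ell d L : ℤ) ^ 2)) := by
    rw [abs_mul, abs_of_nonneg (by positivity : (0 : ℤ) ≤ d !)]
    have := abs_sub (symLinCountAt (toSite r) L μ y f * cCountAt (toSite r) L μ y f')
      (symLinCountAt (toSite r) L μ y f' * cCountAt (toSite r) L μ y f)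
    rw [abs_mul, abs_mul] at this
    have e1 : |symLinCountAt (toSite r) L μ y f| * |cCountAt (toSite r) L μ y f'| ≤ ((d ! : ℤ) * ((L : ℤ) ^ d * ell d L)) * ell d L :=
      mul_le_mul ha (hd.trans hℓ) (abs_nonneg _) (by positivity)
    have e2 : |symLinCountAt (toSite r) L μ y f'| * |cCountAt (toSite r) L μ y f| ≤ ((d ! : ℤ) * ((L : ℤ) ^ d * ell d L)) * ell d L :=
      mul_le_mul hb (hc.trans hℓ) (abs_nonneg _) (by positivity)
    nlinarith
  have h3 : |(d ! : ℤ) ^ 2 * (L : ℤ) ^ d * wedge (segUp (pairForm (δ1 f) (δ1 f')) ((L : ℤ) • y + toSite r) μ L)|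
      ≤ (d ! : ℤ) ^ 2 * ((L : ℤ) ^ d * (ell d L : ℤ) ^ 2) := by
    rw [abs_mul, abs_mul, abs_of_nonneg (by positivity : (0 : ℤ) ≤ (d ! : ℤ) ^ 2),
      abs_of_nonneg (by positivity : (0 : ℤ) ≤ (L : ℤ) ^ d), mul_assoc]
    refine mul_le_mul_of_nonneg_left (mul_le_mul_of_nonneg_left ?_ (by positivity)) (by positivity)
    refine (abs_wedge_le _ (abs_le_one_of_lettersIn_pair (lettersIn_cSegAt _ L μ y hr))).trans ?_
    rw [segUp_length]
    exact pow_le_pow_left₀ hℓ0 hℓ 2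
  rw [symHessCountAt]
  have := abs_add_three (symWedgeCountAt (toSite r) L μ y f f')
    ((d ! : ℤ) * (symLinCountAt (toSite r) L μ y f * cCountAt (toSite r) L μ y f'
      - symLinCountAt (toSite r) L μ y f' * cCountAt (toSite r) L μ y f))
    ((d ! : ℤ) ^ 2 * (L : ℤ) ^ d * wedge (segUp (pairForm (δ1 f) (δ1 f')) ((L : ℤ) • y + toSite r) μ L))
  linarith

/-- [folklore] `|VH⁰⁴| ≤ 6·(d!)²·L^{2d}·ℓ²`. -/
theorem abs_symVhCountAt_le {L : ℕ} (hL : 1 ≤ L) (μ : Fin d) (y : Site d) {r : Fin d → ℕ} (hr : r ∈ box d L) (f f' : Bond d) :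
    |symVhCountAt (toSite r) L μ y f f'| ≤ 6 * (d ! : ℤ) ^ 2 * (L : ℤ) ^ (2 * d) * (ell d L : ℤ) ^ 2 := by
  have hLd : (1 : ℤ) ≤ (L : ℤ) ^ d := by exact_mod_cast Nat.one_le_pow _ _ hL
  have hℓ1 : (1 : ℤ) ≤ ell d L := by have := @le_ell d L; omega
  have hfac : (1 : ℤ) ≤ d ! := by exact_mod_cast Nat.one_le_iff_ne_zero.mpr (Nat.factorial_ne_zero d)
  have hh := abs_symHessCountAt_le hL μ y hr f f'
  have ha := abs_symLinCountAt_le hL μ y hr f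
  have hb := abs_symLinCountAt_le hL μ y hr f'
  have h2d : (L : ℤ) ^ (2 * d) = (L : ℤ) ^ d * (L : ℤ) ^ d := by rw [two_mul, pow_add]
  have hi : |(if f = f' then (d ! : ℤ) * symLinCountAt (toSite r) L μ y f else 0)| ≤ (d ! : ℤ) * ((d ! : ℤ) * ((L : ℤ) ^ d * ell d L)) := by
    split_ifs
    · rw [abs_mul, abs_of_nonneg (by positivity : (0 : ℤ) ≤ d !)]; exact mul_le_mul_of_nonneg_left ha (by positivity)
    · rw [abs_zero]; positivity
  rw [symVhCountAt]
  have t1 := abs_sub ((L : ℤ) ^ d * symHessCountAt (toSite r) L μ y f f'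
      + (L : ℤ) ^ d * (if f = f' then (d ! : ℤ) * symLinCountAt (toSite r) L μ y f else 0))
    (symLinCountAt (toSite r) L μ y f * symLinCountAt (toSite r) L μ y f')
  have t2 := abs_add_le ((L : ℤ) ^ d * symHessCountAt (toSite r) L μ y f f')
    ((L : ℤ) ^ d * (if f = f' then (d ! : ℤ) * symLinCountAt (toSite r) L μ y f else 0))
  rw [abs_mul, abs_mul, abs_of_nonneg (by positivity : (0 : ℤ) ≤ (L : ℤ) ^ d)] at t2
  rw [abs_mul] at t1
  have e1 : (L : ℤ) ^ d * |symHessCountAt (toSite r) L μ y f f'|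
      ≤ (L : ℤ) ^ d * (4 * (d ! : ℤ) ^ 2 * (L : ℤ) ^ d * (ell d L : ℤ) ^ 2) := mul_le_mul_of_nonneg_left hh (by positivity)
  have e2 : (L : ℤ) ^ d * |(if f = f' then (d ! : ℤ) * symLinCountAt (toSite r) L μ y f else 0)|
      ≤ (L : ℤ) ^ d * ((d ! : ℤ) * ((d ! : ℤ) * ((L : ℤ) ^ d * ell d L))) := mul_le_mul_of_nonneg_left hi (by positivity)
  have e3 : |symLinCountAt (toSite r) L μ y f| * |symLinCountAt (toSite r) L μ y f'|
      ≤ ((d ! : ℤ) * ((L : ℤ) ^ d * ell d L)) * ((d ! : ℤ) * ((L : ℤ) ^ d * ell d L)) :=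
    mul_le_mul ha hb (abs_nonneg _) (by positivity)
  have e4 : (L : ℤ) ^ d * ((d ! : ℤ) * ((d ! : ℤ) * ((L : ℤ) ^ d * (ell d L : ℤ))))
      ≤ (L : ℤ) ^ d * ((d ! : ℤ) * ((d ! : ℤ) * ((L : ℤ) ^ d * (ell d L : ℤ) ^ 2))) := by
    refine mul_le_mul_of_nonneg_left (mul_le_mul_of_nonneg_left (mul_le_mul_of_nonneg_left
      (mul_le_mul_of_nonneg_left ?_ (by positivity)) (by positivity)) (by positivity)) (by positivity)
    nlinarith
  rw [h2d]
  nlinarith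

end Bounds

/-! ## §6 Block-translation covariance (coarse index `y ↦ y + t`, bonds shifted by `L·t`, root offset FIXED) -/

section Covariance

/-- [folklore] BLOCK COVARIANCE of `symLinCountAt`. -/
theorem symLinCountAt_add (ρ : Site d) (L : ℕ) (μ : Fin d) (y t : Site d) (f : Bond d) :
    symLinCountAt ρ L μ (y + t) (f.sh ((L : ℤ) • t)) = symLinCountAt ρ L μ y f := by
  simp only [symLinCountAt, symLinU, gammaPAt_add, shift_δ1]

/-- [folklore] BLOCK COVARIANCE of `symWedgeCountAt`. -/
theorem symWedgeCountAt_add (ρ : Site d) (L : ℕ) (μ : Fin d) (y t : Site d) (f f' : Bond d) :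
    symWedgeCountAt ρ L μ (y + t) (f.sh ((L : ℤ) • t)) (f'.sh ((L : ℤ) • t)) = symWedgeCountAt ρ L μ y f f' := by
  simp only [symWedgeCountAt, loopPAt_add, shift_pairForm, shift_δ1]

/-- [folklore] BLOCK COVARIANCE of `symHessCountAt`. -/
theorem symHessCountAt_add (ρ : Site d) (L : ℕ) (μ : Fin d) (y t : Site d) (f f' : Bond d) :
    symHessCountAt ρ L μ (y + t) (f.sh ((L : ℤ) • t)) (f'.sh ((L : ℤ) • t)) = symHessCountAt ρ L μ y f f' := by
  have e : (L : ℤ) • (y + t) + ρ = ((L : ℤ) • y + ρ) + (L : ℤ) • t := by rw [smul_add]; abel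
  simp only [symHessCountAt, symWedgeCountAt_add, e, segUp_add, shift_pairForm, shift_δ1, symLinCountAt_add, cCountAt_add]

/-- [folklore] BLOCK COVARIANCE of `symVhCountAt`. -/
theorem symVhCountAt_add (ρ : Site d) (L : ℕ) (μ : Fin d) (y t : Site d) (f f' : Bond d) :
    symVhCountAt ρ L μ (y + t) (f.sh ((L : ℤ) • t)) (f'.sh ((L : ℤ) • t)) = symVhCountAt ρ L μ y f f' := by
  simp only [symVhCountAt, symHessCountAt_add, symLinCountAt_add, Bond.sh_inj]

end Covariance

end Summit.QuantumFields.BalabanUV.Beta.SymAveragingHessianCounts
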